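import Mathlib
import Summits.QuantumAdvantage.QuantumAdvantage.Theses.MobiusLadder
import Summits.QuantumAdvantage.QuantumAdvantage.Theorems.MobiusLadderLiouvilleNotAC0Xor
import Summits.PneNP.PneNP.Theorems.MobiusDigitalPhasesGlue

/-!
# Route `MobiusLadder`: the crux `DigitPolyUniformity` (stmt-QuantumAdvantage-1392) is EQUIVALENT to the
# PneNP crux `Mobius.LiouvilleDigitalPhases` (stmt-PneNP-1107)

Two summits file the same open problem (polylogarithmic-degree Möbius randomness for `𝔽₂`-phases of the
binary digits; Kalai 2011, Green 2012 p. 3) in two vocabularies: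

* `Summit.QuantumAdvantage.QuantumAdvantage.Theses.MobiusLadder.DigitPolyUniformity` — phases
  `(−1)^{P(bits N)}` of honest polynomials `P : MvPolynomial (Fin n) (ZMod 2)` with
  `P.totalDegree ≤ (log₂ n)^A`, summed over `N < 2ⁿ` (`Nat.testBit`), `∀ᶠ n in atTop`;
* `Summit.PneNP.PneNP.Theses.Mobius.LiouvilleDigitalPhases` — phases of cube functions
  `P ∈ Smolensky.lowDeg (ZMod 2) m ((log₂ m)^c)`, summed over `x : Fin m → Bool` through
  `bitsToNat (List.ofFn x)`, `∃ M, ∀ m ≥ M`.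

The direction `LiouvilleDigitalPhases → DigitPolyUniformity` is landed on the PneNP side
(`Summit.PneNP.PneNP.Theorems.mobius_digitPolyUniformity_of_digitalPhases`, evaluation of a low-degree
polynomial on the cube lies in `lowDeg`). This file proves the converse — a cube function of Smolensky
degree `≤ D` is the cube evaluation of a polynomial of total degree `≤ D`
(`exists_mvPolynomial_of_mem_lowDeg`, landed with the Razborov–Smolensky glue), and the reindexing
`N < 2ⁿ ↔ {0,1}ⁿ` of that glue — and records the equivalence, so the two items are one problem for the
ledger: a proof or refutation of either settles both.

* `liouvilleDigitalPhases_of_digitPolyUniformity : DigitPolyUniformity → LiouvilleDigitalPhases`;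
* `digitPolyUniformity_iff_liouvilleDigitalPhases : DigitPolyUniformity ↔ LiouvilleDigitalPhases`.
-/

set_option linter.dupNamespace false -- D-0017: single-problem summit ⇒ `QuantumAdvantage.QuantumAdvantage` by design

namespace Summit.QuantumAdvantage.QuantumAdvantage.Theorems.MobiusLadder

open Filter Finset
open Literature.Computability.Complexity Literature.Computability.MetaComplexity
open Summit.QuantumAdvantage.QuantumAdvantage.Theses.MobiusLadder

/-- **Reindexing identity** (crux form = cube form): for a polynomial `P` over `𝔽₂` in `n` variables,
`Σ_{N<2ⁿ} λ(N)(−1)^{[P(bits N)=1]} = Σ_{x ∈ {0,1}ⁿ} λ(bitsToNat x)·(−1)^{[P(x) ≠ 0]}`, through the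
bijection `N ↦ bits N`, `x ↦ bitsToNat (List.ofFn x)` (as in the PneNP glue
`mobius_digitPolyUniformity_of_digitalPhases`). [folklore] -/
theorem sum_range_phase_eq_sum_cube {n : ℕ} (P : MvPolynomial (Fin n) (ZMod 2)) :
    ∑ N ∈ Finset.range (2 ^ n), ((ArithmeticFunction.liouville N : ℤ) : ℝ) *
        (if MvPolynomial.eval (fun i : Fin n => if Nat.testBit N i then (1 : ZMod 2) else 0) P = 1
          then (-1 : ℝ) else 1) =
      ∑ x : Fin n → Bool, (ArithmeticFunction.liouville (bitsToNat (List.ofFn x)) : ℝ) *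
        (if MvPolynomial.eval (fun i => if x i then (1 : ZMod 2) else 0) P = 0
          then (1 : ℝ) else -1) := by
  refine Finset.sum_nbij' (fun N => fun i : Fin n => Nat.testBit N i) (fun x => bitsToNat (List.ofFn x))
    (fun N _ => Finset.mem_univ _) (fun x _ => ?_) (fun N hN => ?_) (fun x _ => ?_) (fun N hN => ?_)
  · rw [Finset.mem_range]
    have := bitsToNat_lt (List.ofFn x)
    rwa [List.length_ofFn] at this
  · rw [Finset.mem_range] at hN
    rw [bitsToNat_ofFn_testBit, Nat.mod_eq_of_lt hN]
  · funext i
    rw [testBit_bitsToNat_eq_getD, List.getD_eq_getElem?_getD, List.getElem?_ofFn]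
    simp [i.isLt]
  · rw [Finset.mem_range] at hN
    rw [bitsToNat_ofFn_testBit, Nat.mod_eq_of_lt hN]
    congr 1
    generalize MvPolynomial.eval (fun i : Fin n => if Nat.testBit N i then (1 : ZMod 2) else 0) P = e
    by_cases he : e = 0
    · rw [if_pos he, if_neg (by rw [he]; decide)]
    · have he1 : e = 1 := by revert he; revert e; decide
      rw [if_pos he1, if_neg he]

/-- **`DigitPolyUniformity → LiouvilleDigitalPhases`** (the converse of the PneNP glue's step (1)): a cube
function `Q ∈ lowDeg (ZMod 2) m ((log₂ m)^c)` is the cube evaluation of a polynomial `P` of total degree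
`≤ (log₂ m)^c` (`exists_mvPolynomial_of_mem_lowDeg`), whose crux-form correlation with `λ` is the
cube-form correlation of `Q` (`sum_range_phase_eq_sum_cube`); `∀ᶠ` unfolds to `∃ M, ∀ m ≥ M`. [folklore] -/
theorem liouvilleDigitalPhases_of_digitPolyUniformity :
    Summit.QuantumAdvantage.QuantumAdvantage.Theses.MobiusLadder.DigitPolyUniformity →
      Summit.PneNP.PneNP.Theses.Mobius.LiouvilleDigitalPhases := by
  intro h
  unfold Summit.PneNP.PneNP.Theses.Mobius.LiouvilleDigitalPhases
  intro c ε hε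
  obtain ⟨M, hM⟩ := Filter.eventually_atTop.1 (h c ε hε)
  refine ⟨M, fun m hm Q hQ => ?_⟩
  obtain ⟨P, hPdeg, hPeval⟩ := exists_mvPolynomial_of_mem_lowDeg hQ
  have hf := hM m hm P hPdeg
  rw [sum_range_phase_eq_sum_cube] at hf
  have hsum : ∑ x : Fin m → Bool, (ArithmeticFunction.liouville (bitsToNat (List.ofFn x)) : ℝ) *
        (if Q x = 0 then (1 : ℝ) else -1) =
      ∑ x : Fin m → Bool, (ArithmeticFunction.liouville (bitsToNat (List.ofFn x)) : ℝ) *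
        (if MvPolynomial.eval (fun i => if x i then (1 : ZMod 2) else 0) P = 0
          then (1 : ℝ) else -1) := by
    refine Finset.sum_congr rfl fun x _ => ?_
    rw [hPeval x]
  rw [hsum]
  exact hf

/-- **The two cruxes are one problem**: `DigitPolyUniformity ↔ Mobius.LiouvilleDigitalPhases`
(stmt-QuantumAdvantage-1392 ⟺ stmt-PneNP-1107). [folklore] -/
theorem digitPolyUniformity_iff_liouvilleDigitalPhases :
    Summit.QuantumAdvantage.QuantumAdvantage.Theses.MobiusLadder.DigitPolyUniformity ↔
      Summit.PneNP.PneNP.Theses.Mobius.LiouvilleDigitalPhases := by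
  refine ⟨liouvilleDigitalPhases_of_digitPolyUniformity, fun h => ?_⟩
  unfold DigitPolyUniformity
  exact Summit.PneNP.PneNP.Theorems.mobius_digitPolyUniformity_of_digitalPhases h

end Summit.QuantumAdvantage.QuantumAdvantage.Theorems.MobiusLadder
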